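import Mathlib.Analysis.Calculus.BumpFunction.InnerProduct
import Mathlib.Analysis.Calculus.ContDiff.Bounds
import Mathlib.Analysis.Calculus.SmoothSeries
import Mathlib.Analysis.Calculus.IteratedDeriv.Lemmas
import Mathlib.Data.Nat.Choose.Sum
import Literature.Analysis.Convolution.DixmierMalliavinProduct
import Literature.Analysis.Convolution.DixmierMalliavinFactorization
import HarnessLib

/-!
# The Dixmier–Malliavin kernel on `ℝ`, III: the cut-off kernel `f = χψ`, the commutator series `h`,
# and the kernel package `Σ_{j<n} (−1)ʲ b_j f^{(2j)} → δ + h` — hence `DixmierMalliavin_real`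
# from the uniform annulus bounds

Topic `Literature/Analysis/Convolution`; namespace `Literature.Analysis.Convolution.DixmierMalliavin`.
Theorems only (no definition, no named fact).  Third module of the DISCHARGE of the named fact
`Literature.Analysis.Convolution.DixmierMalliavin_real` (`DixmierMalliavin.lean`; J. Dixmier,
P. Malliavin, Bull. Sci. Math. (2) **102** (1978) 305–330, §3 Thm. 3.1 [DixmierMalliavin1978]), following
D. Hegde, *Schwartz functions, Hadamard products, and the Dixmier–Malliavin theorem*, arXiv:2103.05495
[Hegde2021], §3.2 Lemma 14 and §3.3:

> "(bounds test) Given `B_n > 0`, there exist `0 < b_n < B_n` and `f, h ∈ C_c^∞(ℝ)` such that as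
> `n → ∞`, we have `Σ_{0≤j≤n} (−1)ʲ b_j f^{(2j)} → δ + h`. … Let `ω ∈ C_c^∞(ℝ)` such that `ω(x) = 1`
> for `x ∈ [−1, 1]` and has support in `[−2, 2]`. Let `f = ωψ` … on `1 ≤ |x| ≤ 2`, we have the estimate
> `sup_x |∂ʲ ψ(x)| < c_j` for `j ≥ 1`. Thus for `b_j` sufficiently small … in `(1 − Δ)ⁿ(ωψ)` the
> first term converges to `δ` while the others converge absolutely with all their derivatives to
> functions supported in `1 ≤ |x| ≤ 2`."  [Hegde2021, §3.2 Lemma 14 and its proof, p. 8]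

Module I (`DixmierMalliavinProduct.lean`, seat cc-t14) constructs, for every admissible scale sequence
`c` (`IsAdmissible c`), the kernel `ψ = psi c 0 = 𝓕 r₀`, `r₀(ξ) = Π_n (1 + (2π c_n ξ)²)⁻¹`, its
coefficients `b_j = coeff c j` (`b₀ = 1`), the exact kernel identity
`Σ_{j<n} (−1)ʲ b_j ψ^{(2j)} = 𝓕(s_n r₀)` (`IsAdmissible.kernel_eq_fourier`) and the approximate identity
`∫ 𝓕(s_n r₀) σ → σ(0)` (`IsAdmissible.tendsto_integral_fourier_sfin_mul`), and the choice of scales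
against any growth (`exists_isAdmissible_coeff_mul_le`).  Module II supplies the UNIFORM ANNULUS
BOUNDS `sup_{|x| ≥ 1/2} ‖ψ^{(n)}(x)‖ ≤ K n` over the admissible class (contour shift
`Literature.Analysis.Complex.norm_fourier_inv_prod_one_add_sq_le` + the recursion
`IsAdmissible.psi_sub_psi_succ`).  THIS module performs the assembly of the quoted proof, taking the
annulus bounds as an explicit hypothesis `hK` (so that it lands independently of module II):

* `norm_iteratedDeriv_mul_le_two_pow` — the Leibniz bound `‖(ωψ)^{(n)}(y)‖ ≤ 2ⁿ W K` from pointwise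
  bounds `‖ω^{(i)}(y)‖ ≤ W`, `‖ψ^{(i)}(y)‖ ≤ K`, `i ≤ n` (Mathlib `norm_iteratedFDeriv_mul_le`);
* the commutators `C_j = (ωψ)^{(2j)} − ω ψ^{(2j)}` (passed as a function `C` with its defining
  equation `hC`, to keep the file definition-free): smooth (`contDiff_comm`), `C_j^{(l)} =
  (ωψ)^{(2j+l)} − (ωψ^{(2j)})^{(l)}` (`iteratedDeriv_comm`), identically zero with all derivatives where
  `ω` is locally `1` or locally `0` (`iteratedDeriv_comm_eq_zero_of_eq_one/_of_eq_zero` — no Leibniz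
  identity is needed for the support statement), and the bound
  `‖C_j^{(l)}(y)‖ ≤ 2^{2j+l+1} W_{2j+l} K_{2j+l}` for ALL `y` from envelopes of `ω` on `ℝ` and of `ψ` on
  `{|y| ≥ 1/2}` (`norm_iteratedDeriv_comm_le`);
* `exists_kernel_package_of_annulusBound` — for every `M : ℕ → ℝ`: `ω :=` Mathlib's
  `ContDiffBump (0:ℝ)` with radii `1 < 2` (coerced to `ℂ`), `c` admissible with
  `b_j max(M_j, N_j) ≤ 1` (`j ≥ 1`) where `N_j = 2ʲ Σ_{l≤j} 2^{2j+l+1} W_{2j+l} K_{2j+l}`, `f := ωψ`,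
  `h := Σ_j (−1)ʲ b_j C_j` (`contDiff_tsum`: `b_j‖C_j^{(l)}‖_∞ ≤ 2^{−j}` for `j ≥ max(l,1)`; support in
  `{|y| ≤ 2}`); then `Σ_{j<n}(−1)ʲ b_j f^{(2j)} = ω·𝓕(s_n r₀) + Σ_{j<n}(−1)ʲ b_j C_j`, the first part
  tested against `φ(x − ·)` is the approximate identity tested on `σ = ω·φ(x − ·)` (`→ σ(0) = φ(x)`),
  the second converges to `∫ h(y)φ(x − y)dy` by dominated convergence — which is EXACTLY the hypothesis
  of the factorization step `Literature.Analysis.Convolution.dixmierMalliavin_real_of_kernels_of_pos`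
  (`DixmierMalliavinFactorization.lean`, `b₀ = 1`, no rescaling);
* `dixmierMalliavin_real_of_annulusBound` — hence `DixmierMalliavin_real` from the annulus bounds.

The capstone `DixmierMalliavin_real_holds` is the three-line combination of this theorem with
module II's export `∃ K, ∀ c, IsAdmissible c → ∀ n x, 1/2 ≤ |x| → ‖iteratedDeriv n (psi c 0) x‖ ≤ K n`.
RH-context: the fact is the one classical input of the OFF-PATH strong form of Connes–Consani 2021
Thm. 4.7 (`Literature.NumberTheory.ConnesConsani2021.CC2021_thm_4_7_of_dixmierMalliavin`); this file is
pure classical analysis and bears on no statement about `ζ`; nothing here bears on the truth of RH.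

## References
* J. Dixmier, P. Malliavin, *Factorisations de fonctions et de vecteurs indéfiniment différentiables*,
  Bull. Sci. Math. (2) 102 (1978) 305–330, §2 Lemmes 2.6–2.8, §3 Thm. 3.1. [DixmierMalliavin1978]
* D. Hegde, *Schwartz functions, Hadamard products, and the Dixmier–Malliavin theorem*,
  arXiv:2103.05495 (2021), §3.2 Lemma 14, §3.3 Thm. 18, Rem. 15. [Hegde2021]
-/

noncomputable section

open MeasureTheory Filter Set Function Complex
open scoped ContDiff Topology FourierTransform

namespace Literature.Analysis.Convolution

namespace DixmierMalliavin

/-! ### 1. Iterated derivatives: plumbing -/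

section Prelim

variable {φ : ℝ → ℂ}

/-- Derivatives of a smooth function are smooth. [folklore] -/
private theorem contDiff_iteratedDeriv_of_top (hφ : ContDiff ℝ ∞ φ) (m : ℕ) :
    ContDiff ℝ ∞ (iteratedDeriv m φ) := by
  rw [iteratedDeriv_eq_iterate]
  exact hφ.iterate_deriv m

/-- Derivatives of a compactly supported function are compactly supported. [folklore] -/
private theorem hasCompactSupport_iteratedDeriv_of (hφc : HasCompactSupport φ) (m : ℕ) :
    HasCompactSupport (iteratedDeriv m φ) := by
  induction m with
  | zero => simpa using hφc
  | succ m ih => rw [iteratedDeriv_succ]; exact ih.deriv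

/-- Each derivative of a test function is bounded. [folklore] -/
private theorem exists_bound_iteratedDeriv_of (hφ : ContDiff ℝ ∞ φ) (hφc : HasCompactSupport φ)
    (m : ℕ) : ∃ C : ℝ, 0 ≤ C ∧ ∀ x, ‖iteratedDeriv m φ x‖ ≤ C := by
  obtain ⟨C, hC⟩ := ((contDiff_iteratedDeriv_of_top hφ m).continuous).bounded_above_of_compact_support
    (hasCompactSupport_iteratedDeriv_of hφc m)
  exact ⟨max C 0, le_max_right _ _, fun x => (hC x).trans (le_max_left _ _)⟩

/-- `(φ^{(m)})^{(l)} = φ^{(l+m)}`. [folklore] -/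
private theorem iteratedDeriv_iteratedDeriv_eq (l m : ℕ) (φ : ℝ → ℂ) :
    iteratedDeriv l (iteratedDeriv m φ) = iteratedDeriv (l + m) φ := by
  rw [iteratedDeriv_eq_iterate, iteratedDeriv_eq_iterate, iteratedDeriv_eq_iterate,
    Function.iterate_add_apply]

end Prelim

/-! ### 2. The Leibniz bound with envelopes -/

/-- **Leibniz bound, envelope form**: if `‖χ^{(i)}(y)‖ ≤ W` and `‖ψ^{(i)}(y)‖ ≤ K` for all `i ≤ n`
(`χ, ψ` smooth), then `‖(χψ)^{(n)}(y)‖ ≤ 2ⁿ W K` (Mathlib's `norm_iteratedFDeriv_mul_le` and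
`Σ_i C(n,i) = 2ⁿ`). [cite: Hegde2021, §3.2 Lemma 14 (p. 8), proof] -/
theorem norm_iteratedDeriv_mul_le_two_pow {χ ψ : ℝ → ℂ} (hχ : ContDiff ℝ ∞ χ) (hψ : ContDiff ℝ ∞ ψ)
    (n : ℕ) (y : ℝ) {W K : ℝ} (hW0 : 0 ≤ W)
    (hW : ∀ i, i ≤ n → ‖iteratedDeriv i χ y‖ ≤ W) (hK : ∀ i, i ≤ n → ‖iteratedDeriv i ψ y‖ ≤ K) :
    ‖iteratedDeriv n (fun z => χ z * ψ z) y‖ ≤ 2 ^ n * (W * K) := by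
  have hK0 : 0 ≤ K := (norm_nonneg _).trans (hK 0 (Nat.zero_le n))
  rw [← norm_iteratedFDeriv_eq_norm_iteratedDeriv]
  refine (norm_iteratedFDeriv_mul_le hχ hψ y (n := n) (mod_cast le_top)).trans ?_
  calc ∑ i ∈ Finset.range (n + 1),
        (n.choose i : ℝ) * ‖iteratedFDeriv ℝ i χ y‖ * ‖iteratedFDeriv ℝ (n - i) ψ y‖
      ≤ ∑ i ∈ Finset.range (n + 1), (n.choose i : ℝ) * W * K := by
        refine Finset.sum_le_sum fun i hi => ?_
        have hi' : i ≤ n := Nat.lt_succ_iff.1 (Finset.mem_range.1 hi)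
        rw [norm_iteratedFDeriv_eq_norm_iteratedDeriv, norm_iteratedFDeriv_eq_norm_iteratedDeriv]
        have h1 := hW i hi'
        have h2 := hK (n - i) (Nat.sub_le n i)
        have h3 : (0 : ℝ) ≤ n.choose i := Nat.cast_nonneg _
        calc (n.choose i : ℝ) * ‖iteratedDeriv i χ y‖ * ‖iteratedDeriv (n - i) ψ y‖
            ≤ (n.choose i : ℝ) * W * ‖iteratedDeriv (n - i) ψ y‖ := by gcongr
          _ ≤ (n.choose i : ℝ) * W * K := by gcongr
    _ = (∑ i ∈ Finset.range (n + 1), (n.choose i : ℝ)) * (W * K) := by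
        rw [Finset.sum_mul]; refine Finset.sum_congr rfl fun i _ => by ring
    _ = 2 ^ n * (W * K) := by
        congr 1
        have := Nat.sum_range_choose n
        exact_mod_cast this

/-! ### 3. The commutator `C_j = (χψ)^{(2j)} − χ ψ^{(2j)}` -/

section Commutator

variable {χ ψ : ℝ → ℂ} (hχ : ContDiff ℝ ∞ χ) (hψ : ContDiff ℝ ∞ ψ)
  {C : ℕ → ℝ → ℂ}
  (hC : ∀ j y, C j y = iteratedDeriv (2 * j) (fun z => χ z * ψ z) y - χ y * iteratedDeriv (2 * j) ψ y)

include hC in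
/-- The commutator as a function (unfolding `hC`). [folklore] -/
private theorem comm_eq (j : ℕ) :
    C j = fun y => iteratedDeriv (2 * j) (fun z => χ z * ψ z) y -
      χ y * iteratedDeriv (2 * j) ψ y :=
  funext (hC j)

include hχ hψ hC in
/-- `C_j` is smooth. [cite: Hegde2021, §3.2 Lemma 14 (p. 8), proof] -/
theorem contDiff_comm (j : ℕ) : ContDiff ℝ ∞ (C j) := by
  rw [comm_eq hC j]
  exact (contDiff_iteratedDeriv_of_top (hχ.mul hψ) _).sub
    (hχ.mul (contDiff_iteratedDeriv_of_top hψ _))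

include hχ hψ hC in
/-- The derivatives of the commutator: `C_j^{(l)} = (χψ)^{(2j+l)} − (χ ψ^{(2j)})^{(l)}`.
[cite: Hegde2021, §3.2 Lemma 14 (p. 8), proof] -/
theorem iteratedDeriv_comm (j l : ℕ) (y : ℝ) :
    iteratedDeriv l (C j) y = iteratedDeriv (l + 2 * j) (fun z => χ z * ψ z) y -
      iteratedDeriv l (fun z => χ z * iteratedDeriv (2 * j) ψ z) y := by
  rw [comm_eq hC j, iteratedDeriv_fun_sub
    (((contDiff_iteratedDeriv_of_top (hχ.mul hψ) (2 * j)).of_le (mod_cast le_top)).contDiffAt)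
    (((hχ.mul (contDiff_iteratedDeriv_of_top hψ (2 * j))).of_le (mod_cast le_top)).contDiffAt),
    ← iteratedDeriv_iteratedDeriv_eq]

include hC in
/-- `C_j` vanishes identically, with all its derivatives, on any open set where `χ ≡ 1`.
[cite: Hegde2021, §3.2 Lemma 14 (p. 8), proof] -/
theorem iteratedDeriv_comm_eq_zero_of_eq_one {U : Set ℝ} (hU : IsOpen U) (h1 : ∀ z ∈ U, χ z = 1)
    (j l : ℕ) {y : ℝ} (hy : y ∈ U) : iteratedDeriv l (C j) y = 0 := by
  have hzero : ∀ z ∈ U, C j z = 0 := by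
    intro z hz
    have hev : (fun w => χ w * ψ w) =ᶠ[𝓝 z] ψ := by
      filter_upwards [hU.mem_nhds hz] with w hw
      rw [h1 w hw, one_mul]
    rw [hC, hev.iteratedDeriv_eq, h1 z hz, one_mul, sub_self]
  have hev : C j =ᶠ[𝓝 y] fun _ => (0 : ℂ) := by
    filter_upwards [hU.mem_nhds hy] with w hw
    exact hzero w hw
  rw [hev.iteratedDeriv_eq]
  simp

include hC in
/-- `C_j` vanishes identically, with all its derivatives, on any open set where `χ ≡ 0`.
[cite: Hegde2021, §3.2 Lemma 14 (p. 8), proof] -/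
theorem iteratedDeriv_comm_eq_zero_of_eq_zero {U : Set ℝ} (hU : IsOpen U) (h0 : ∀ z ∈ U, χ z = 0)
    (j l : ℕ) {y : ℝ} (hy : y ∈ U) : iteratedDeriv l (C j) y = 0 := by
  have hzero : ∀ z ∈ U, C j z = 0 := by
    intro z hz
    have hev : (fun w => χ w * ψ w) =ᶠ[𝓝 z] fun _ => (0 : ℂ) := by
      filter_upwards [hU.mem_nhds hz] with w hw
      rw [h0 w hw, zero_mul]
    rw [hC, hev.iteratedDeriv_eq, h0 z hz, zero_mul, sub_zero]
    simp
  have hev : C j =ᶠ[𝓝 y] fun _ => (0 : ℂ) := by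
    filter_upwards [hU.mem_nhds hy] with w hw
    exact hzero w hw
  rw [hev.iteratedDeriv_eq]
  simp

include hχ hψ hC in
/-- **The commutator bound.**  With monotone envelopes `W m ≥ sup_{i≤m} ‖χ^{(i)}‖_∞` and
`Ks m ≥ sup_{i≤m} sup_{|y|≥1/2} ‖ψ^{(i)}(y)‖`, and `χ ≡ 1` on `{|y| < 1}`: for all `j, l, y`,
`‖C_j^{(l)}(y)‖ ≤ 2^{2j+l+1} W_{2j+l} K_{2j+l}` (zero on `{|y| < 1}`; Leibniz twice on `{|y| ≥ 1/2}`).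
[cite: Hegde2021, §3.2 Lemma 14 (p. 8)] -/
theorem norm_iteratedDeriv_comm_le {W Ks : ℕ → ℝ} (hW0 : ∀ m, 0 ≤ W m) (hK0 : ∀ m, 0 ≤ Ks m)
    (hWenv : ∀ i m, i ≤ m → ∀ y, ‖iteratedDeriv i χ y‖ ≤ W m)
    (hKenv : ∀ i m, i ≤ m → ∀ y : ℝ, (1 : ℝ) / 2 ≤ |y| → ‖iteratedDeriv i ψ y‖ ≤ Ks m)
    (hχ1 : ∀ z : ℝ, |z| < 1 → χ z = 1) (j l : ℕ) (y : ℝ) :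
    ‖iteratedDeriv l (C j) y‖ ≤ 2 ^ (2 * j + l + 1) * (W (2 * j + l) * Ks (2 * j + l)) := by
  by_cases hy : |y| < 1
  · rw [iteratedDeriv_comm_eq_zero_of_eq_one hC (isOpen_lt continuous_abs continuous_const)
      (fun z hz => hχ1 z hz) j l hy, norm_zero]
    exact mul_nonneg (by positivity) (mul_nonneg (hW0 _) (hK0 _))
  · have hy' : (1 : ℝ) / 2 ≤ |y| := by linarith [not_lt.1 hy]
    rw [iteratedDeriv_comm hχ hψ hC]
    refine (norm_sub_le _ _).trans ?_
    have hA : ‖iteratedDeriv (l + 2 * j) (fun z => χ z * ψ z) y‖ ≤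
        2 ^ (l + 2 * j) * (W (2 * j + l) * Ks (2 * j + l)) :=
      norm_iteratedDeriv_mul_le_two_pow hχ hψ _ y (hW0 _)
        (fun i hi => hWenv i _ (by omega) y) (fun i hi => hKenv i _ (by omega) y hy')
    have hB : ‖iteratedDeriv l (fun z => χ z * iteratedDeriv (2 * j) ψ z) y‖ ≤
        2 ^ l * (W (2 * j + l) * Ks (2 * j + l)) := by
      refine norm_iteratedDeriv_mul_le_two_pow hχ (contDiff_iteratedDeriv_of_top hψ _) _ y (hW0 _)
        (fun i hi => hWenv i _ (by omega) y) (fun i hi => ?_)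
      rw [iteratedDeriv_iteratedDeriv_eq]
      exact hKenv (i + 2 * j) _ (by omega) y hy'
    have hWK : 0 ≤ W (2 * j + l) * Ks (2 * j + l) := mul_nonneg (hW0 _) (hK0 _)
    have hpow : (2 : ℝ) ^ (l + 2 * j) + 2 ^ l ≤ 2 ^ (2 * j + l + 1) := by
      have h1 : (2 : ℝ) ^ l ≤ 2 ^ (2 * j + l) := pow_le_pow_right₀ (by norm_num) (by omega)
      rw [show l + 2 * j = 2 * j + l by ring, pow_succ]
      linarith
    calc ‖iteratedDeriv (l + 2 * j) (fun z => χ z * ψ z) y‖ +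
          ‖iteratedDeriv l (fun z => χ z * iteratedDeriv (2 * j) ψ z) y‖
        ≤ 2 ^ (l + 2 * j) * (W (2 * j + l) * Ks (2 * j + l)) +
          2 ^ l * (W (2 * j + l) * Ks (2 * j + l)) := add_le_add hA hB
      _ = (2 ^ (l + 2 * j) + 2 ^ l) * (W (2 * j + l) * Ks (2 * j + l)) := by ring
      _ ≤ 2 ^ (2 * j + l + 1) * (W (2 * j + l) * Ks (2 * j + l)) :=
          mul_le_mul_of_nonneg_right hpow hWK

end Commutator

/-! ### 4. The kernel package from the uniform annulus bounds -/

/-- **The Dixmier–Malliavin kernel package (Hegde2021 Lemma 14 + §3.3), from the uniform annulus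
bounds.**  Suppose the kernels `ψ = psi c 0` of ALL admissible scale sequences obey
`‖ψ^{(n)}(x)‖ ≤ K n` for `|x| ≥ 1/2` (module II).  Then for every prescribed growth `M : ℕ → ℝ` there
are `b ≥ 0` with `b_j M_j ≤ 1` (`j ≥ 1`) and `f, h ∈ C_c^∞(ℝ; ℂ)` with
`∫ (Σ_{j<n} (−1)ʲ b_j f^{(2j)})(y) φ(x − y) dy → φ(x) + ∫ h(y) φ(x − y) dy` for every test function
`φ` and every `x` — the hypothesis of the factorization step
`Literature.Analysis.Convolution.dixmierMalliavin_real_of_kernels_of_pos`, VERBATIM.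
Construction ("let `χ` be `1` on `[−1,1]` with support in `[−2,2]`, `f = χψ`; on `1 ≤ |x| ≤ 2` the
derivatives of `ψ` obey uniform bounds, so for `b_j` small the commutator series converges to a smooth
`h`"): `χ` = Mathlib's `ContDiffBump (0:ℝ)` with radii `1 < 2`; `b = coeff c` for the admissible `c` of
`exists_isAdmissible_coeff_mul_le` run against `max (M j) (N j)`, `N_j = 2ʲ Σ_{l≤j} 2^{2j+l+1} W_{2j+l} K_{2j+l}`;
`C_j = (χψ)^{(2j)} − χψ^{(2j)}` (`norm_iteratedDeriv_comm_le`), `h = Σ_j (−1)ʲ b_j C_j` (`contDiff_tsum`);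
`Σ_{j<n}(−1)ʲ b_j f^{(2j)} = χ·𝓕(s_n r₀) + Σ_{j<n}(−1)ʲ b_j C_j` (`IsAdmissible.kernel_eq_fourier`); the
first part tends to `φ(x)` by the approximate identity `IsAdmissible.tendsto_integral_fourier_sfin_mul`
tested on `σ = χ·φ(x − ·)`, the second to `∫ h φ(x − ·)` by dominated convergence.
[cite: Hegde2021, §3.2 Lemma 14 (p. 8); §3.3 proof of Thm. 18] [cite: DixmierMalliavin1978, §2 Lemme 2.6–2.8, §3 Thm. 3.1] -/
theorem exists_kernel_package_of_annulusBound (K : ℕ → ℝ)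
    (hK : ∀ c : ℕ → ℝ, IsAdmissible c → ∀ (n : ℕ) (x : ℝ), (1 : ℝ) / 2 ≤ |x| →
      ‖iteratedDeriv n (psi c 0) x‖ ≤ K n) (M : ℕ → ℝ) :
    ∃ (b : ℕ → ℝ) (f h : ℝ → ℂ),
      (∀ j, 0 ≤ b j) ∧ (∀ j, 1 ≤ j → b j * M j ≤ 1) ∧ ContDiff ℝ ∞ f ∧ HasCompactSupport f ∧
      ContDiff ℝ ∞ h ∧ HasCompactSupport h ∧
      ∀ φ : ℝ → ℂ, ContDiff ℝ ∞ φ → HasCompactSupport φ → ∀ x : ℝ,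
        Tendsto (fun n => ∫ y, (∑ j ∈ Finset.range n,
            (-1 : ℂ) ^ j * b j * iteratedDeriv (2 * j) f y) * φ (x - y))
          atTop (𝓝 (φ x + ∫ y, h y * φ (x - y))) := by
  classical
  /- Step 0: the cut-off `χ` (= 1 on `|y| ≤ 1`, = 0 on `|y| ≥ 2`) and its envelopes. -/
  let β : ContDiffBump (0 : ℝ) := ⟨1, 2, one_pos, one_lt_two⟩
  set χ : ℝ → ℂ := fun y => ((β y : ℝ) : ℂ) with hχ_def
  have hχs : ContDiff ℝ ∞ χ := ofRealCLM.contDiff.comp β.contDiff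
  have hχc : HasCompactSupport χ := β.hasCompactSupport.comp_left Complex.ofReal_zero
  have hχ1 : ∀ z : ℝ, |z| < 1 → χ z = 1 := fun z hz => by
    have : β z = 1 := β.one_of_mem_closedBall (by
      rw [Metric.mem_closedBall, Real.dist_eq, sub_zero]; exact hz.le)
    simp [hχ_def, this]
  have hχ0 : ∀ z : ℝ, 2 < |z| → χ z = 0 := fun z hz => by
    have : β z = 0 := β.zero_of_le_dist (by rw [Real.dist_eq, sub_zero]; exact hz.le)
    simp [hχ_def, this]
  have hχ_zero : χ 0 = 1 := hχ1 0 (by norm_num)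
  choose Wf hWf0 hWf using exists_bound_iteratedDeriv_of hχs hχc
  set W : ℕ → ℝ := fun m => ∑ i ∈ Finset.range (m + 1), Wf i with hW_def
  have hW0 : ∀ m, 0 ≤ W m := fun m => Finset.sum_nonneg fun i _ => hWf0 i
  have hWenv : ∀ i m, i ≤ m → ∀ y, ‖iteratedDeriv i χ y‖ ≤ W m := fun i m him y =>
    (hWf i y).trans (Finset.single_le_sum (fun i _ => hWf0 i)
      (Finset.mem_range.2 (Nat.lt_succ_of_le him)))
  set Ks : ℕ → ℝ := fun m => ∑ i ∈ Finset.range (m + 1), max (K i) 0 with hKs_def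
  have hK0 : ∀ m, 0 ≤ Ks m := fun m => Finset.sum_nonneg fun i _ => le_max_right _ _
  have hKs_ge : ∀ i m, i ≤ m → K i ≤ Ks m := fun i m him =>
    (le_max_left (K i) 0).trans (Finset.single_le_sum (fun i _ => le_max_right (K i) 0)
      (Finset.mem_range.2 (Nat.lt_succ_of_le him)))
  -- the commutator constants and the growth they impose
  set U : ℕ → ℕ → ℝ := fun l j => 2 ^ (2 * j + l + 1) * (W (2 * j + l) * Ks (2 * j + l)) with hU_def
  have hU0 : ∀ l j, 0 ≤ U l j := fun l j => mul_nonneg (by positivity) (mul_nonneg (hW0 _) (hK0 _))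
  set N : ℕ → ℝ := fun j => 2 ^ j * ∑ l ∈ Finset.range (j + 1), U l j with hN_def
  have hNU : ∀ l j, l ≤ j → 2 ^ j * U l j ≤ N j := fun l j hlj =>
    mul_le_mul_of_nonneg_left (Finset.single_le_sum (fun l _ => hU0 l j)
      (Finset.mem_range.2 (Nat.lt_succ_of_le hlj))) (by positivity)
  /- Step 1: the scales. -/
  obtain ⟨c, hc, hcM⟩ := exists_isAdmissible_coeff_mul_le fun j => max (M j) (N j)
  set b : ℕ → ℝ := coeff c with hb_def
  have hb0 : ∀ j, 0 ≤ b j := fun j => hc.coeff_nonneg j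
  have hbM : ∀ j, 1 ≤ j → b j * M j ≤ 1 := fun j hj =>
    (mul_le_mul_of_nonneg_left (le_max_left _ _) (hb0 j)).trans (hcM j hj)
  have hbN : ∀ j, 1 ≤ j → b j * N j ≤ 1 := fun j hj =>
    (mul_le_mul_of_nonneg_left (le_max_right _ _) (hb0 j)).trans (hcM j hj)
  set ψ : ℝ → ℂ := psi c 0 with hψ_def
  have hψ : ContDiff ℝ ∞ ψ := hc.contDiff_psi 0
  have hKenv : ∀ i m, i ≤ m → ∀ y : ℝ, (1 : ℝ) / 2 ≤ |y| → ‖iteratedDeriv i ψ y‖ ≤ Ks m :=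
    fun i m him y hy => (hK c hc i y hy).trans (hKs_ge i m him)
  /- Step 2: `f = χψ`, the commutators `C_j`, the series `h`. -/
  set f : ℝ → ℂ := fun y => χ y * ψ y with hf_def
  have hf : ContDiff ℝ ∞ f := hχs.mul hψ
  have hfc : HasCompactSupport f := hχc.mul_right
  set C : ℕ → ℝ → ℂ := fun j y => iteratedDeriv (2 * j) f y - χ y * iteratedDeriv (2 * j) ψ y
    with hC_def
  have hC : ∀ j y, C j y = iteratedDeriv (2 * j) (fun z => χ z * ψ z) y -
      χ y * iteratedDeriv (2 * j) ψ y := fun j y => rfl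
  have hCs : ∀ j, ContDiff ℝ ∞ (C j) := contDiff_comm hχs hψ hC
  have hCb : ∀ j l y, ‖iteratedDeriv l (C j) y‖ ≤ U l j := fun j l y =>
    norm_iteratedDeriv_comm_le hχs hψ hC hW0 hK0 hWenv hKenv hχ1 j l y
  have hC2 : ∀ j y, 2 < |y| → C j y = 0 := fun j y hy => by
    have := iteratedDeriv_comm_eq_zero_of_eq_zero hC
      (isOpen_lt continuous_const continuous_abs) (fun z hz => hχ0 z hz) j 0 hy
    simpa using this
  set t : ℕ → ℝ → ℂ := fun j y => (-1 : ℂ) ^ j * b j * C j y with ht_def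
  have hts : ∀ j, ContDiff ℝ ∞ (t j) := fun j => contDiff_const.mul (hCs j)
  have ht_norm : ∀ j y, ‖t j y‖ = b j * ‖C j y‖ := fun j y => by
    simp only [ht_def, norm_mul, norm_pow, norm_neg, norm_one, one_pow, one_mul, Complex.norm_real,
      Real.norm_eq_abs, abs_of_nonneg (hb0 j)]
  have ht_bound : ∀ (l j : ℕ) (y : ℝ), ‖iteratedFDeriv ℝ l (t j) y‖ ≤ b j * U l j := by
    intro l j y
    rw [norm_iteratedFDeriv_eq_norm_iteratedDeriv]
    have e : iteratedDeriv l (t j) y = (-1 : ℂ) ^ j * b j * iteratedDeriv l (C j) y := by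
      rw [ht_def]
      exact iteratedDeriv_const_mul_field _ _
    rw [e]
    simp only [norm_mul, norm_pow, norm_neg, norm_one, one_pow, one_mul, Complex.norm_real,
      Real.norm_eq_abs, abs_of_nonneg (hb0 j)]
    exact mul_le_mul_of_nonneg_left (hCb j l y) (hb0 j)
  -- summability: `b_j U_{l,j} ≤ 2^{-j}` for `j ≥ max l 1`
  have hsum : ∀ l : ℕ, Summable fun j => b j * U l j := by
    intro l
    refine Summable.of_norm_bounded_eventually_nat (g := fun j : ℕ => ((1:ℝ) / 2) ^ j)
      (summable_geometric_of_lt_one (by norm_num) (by norm_num)) ?_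
    filter_upwards [Filter.eventually_ge_atTop (max l 1)] with j hj
    have hjl : l ≤ j := le_trans (le_max_left _ _) hj
    have hj1 : 1 ≤ j := le_trans (le_max_right _ _) hj
    rw [Real.norm_eq_abs, abs_of_nonneg (mul_nonneg (hb0 j) (hU0 l j))]
    have h3 : b j * U l j * 2 ^ j ≤ 1 := by
      calc b j * U l j * 2 ^ j = b j * (2 ^ j * U l j) := by ring
        _ ≤ b j * N j := mul_le_mul_of_nonneg_left (hNU l j hjl) (hb0 j)
        _ ≤ 1 := hbN j hj1
    rw [div_pow, one_pow, le_div_iff₀ (by positivity)]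
    exact h3
  set h : ℝ → ℂ := fun y => ∑' j, t j y with hh_def
  have hh : ContDiff ℝ ∞ h :=
    contDiff_tsum (N := (⊤ : ℕ∞)) hts (fun k _ => hsum k) (fun k j y _ => ht_bound k j y)
  have hhc : HasCompactSupport h := by
    refine HasCompactSupport.intro (isCompact_closedBall (0 : ℝ) 2) fun y hy => ?_
    have hy' : 2 < |y| := by
      rw [Metric.mem_closedBall, Real.dist_eq, sub_zero, not_le] at hy; exact hy
    rw [hh_def]
    simp only
    refine (tsum_congr fun j => ?_).trans tsum_zero
    rw [ht_def]
    simp only [hC2 j y hy', mul_zero]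
  -- pointwise summability of the series and the uniform `L^∞` bound of its partial sums
  have ht_sum : ∀ y, Summable fun j => t j y := fun y =>
    Summable.of_norm_bounded (hsum 0) fun j => by
      rw [ht_norm]
      have := hCb j 0 y
      rw [iteratedDeriv_zero] at this
      exact mul_le_mul_of_nonneg_left this (hb0 j)
  set S : ℝ := ∑' j, b j * U 0 j with hS_def
  have hHs_le : ∀ n y, ‖∑ j ∈ Finset.range n, t j y‖ ≤ S := fun n y => by
    refine (norm_sum_le _ _).trans ?_
    calc ∑ j ∈ Finset.range n, ‖t j y‖ ≤ ∑ j ∈ Finset.range n, b j * U 0 j := by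
          refine Finset.sum_le_sum fun j _ => ?_
          rw [ht_norm]
          have := hCb j 0 y
          rw [iteratedDeriv_zero] at this
          exact mul_le_mul_of_nonneg_left this (hb0 j)
      _ ≤ S := (hsum 0).sum_le_tsum _ fun j _ => mul_nonneg (hb0 j) (hU0 0 j)
  refine ⟨b, f, h, hb0, hbM, hf, hfc, hh, hhc, fun φ hφ hφc x => ?_⟩
  /- Step 3: the limit. -/
  -- the test function `σ = χ · φ(x − ·)` and the reflected translate of `φ`
  have hφx : ContDiff ℝ ∞ fun y => φ (x - y) := hφ.comp (contDiff_const.sub contDiff_id)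
  have hφxc : HasCompactSupport fun y => φ (x - y) :=
    hφc.comp_homeomorph (Homeomorph.subLeft x)
  set σ : ℝ → ℂ := fun y => χ y * φ (x - y) with hσ_def
  have hσ : ContDiff ℝ ∞ σ := hχs.mul hφx
  have hσc : HasCompactSupport σ := hχc.mul_right
  have hσ0 : σ 0 = φ x := by simp [hσ_def, hχ_zero]
  -- the split `Σ_{j<n} (-1)^j b_j f^{(2j)} = χ G_n + H_n`
  set G : ℕ → ℝ → ℂ := fun n y => ∑ j ∈ Finset.range n,
    (-1 : ℂ) ^ j * b j * iteratedDeriv (2 * j) ψ y with hG_def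
  set Hs : ℕ → ℝ → ℂ := fun n y => ∑ j ∈ Finset.range n, t j y with hHs_def
  have hsplit : ∀ n y, (∑ j ∈ Finset.range n, (-1 : ℂ) ^ j * b j * iteratedDeriv (2 * j) f y) *
      φ (x - y) = G n y * σ y + Hs n y * φ (x - y) := by
    intro n y
    have : ∑ j ∈ Finset.range n, (-1 : ℂ) ^ j * b j * iteratedDeriv (2 * j) f y =
        χ y * G n y + Hs n y := by
      rw [hG_def, hHs_def]
      simp only [ht_def, hC_def, Finset.mul_sum, ← Finset.sum_add_distrib]
      exact Finset.sum_congr rfl fun j _ => by ring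
    rw [this, hσ_def]
    ring
  -- continuity / integrability of the pieces
  have hGc : ∀ n, Continuous (G n) := fun n => by
    rw [hG_def]
    exact continuous_finsetSum _ fun j _ =>
      continuous_const.mul (contDiff_iteratedDeriv_of_top hψ _).continuous
  have hHsc : ∀ n, Continuous (Hs n) := fun n => by
    rw [hHs_def]
    exact continuous_finsetSum _ fun j _ => (hts j).continuous
  have hint1 : ∀ n, Integrable fun y => G n y * σ y := fun n =>
    ((hGc n).mul hσ.continuous).integrable_of_hasCompactSupport hσc.mul_left
  have hint2 : ∀ n, Integrable fun y => Hs n y * φ (x - y) := fun n =>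
    ((hHsc n).mul hφx.continuous).integrable_of_hasCompactSupport hφxc.mul_left
  -- term 1: the approximate identity tested on `σ`
  have hT1 : Tendsto (fun n => ∫ y, G n y * σ y) atTop (𝓝 (φ x)) := by
    rw [← hσ0]
    refine (hc.tendsto_integral_fourier_sfin_mul hσ hσc).congr fun n => ?_
    refine integral_congr_ae (ae_of_all _ fun y => ?_)
    simp only [hG_def, hb_def, hψ_def]
    rw [hc.kernel_eq_fourier n y]
  -- term 2: dominated convergence for the commutator series
  have hT2 : Tendsto (fun n => ∫ y, Hs n y * φ (x - y)) atTop (𝓝 (∫ y, h y * φ (x - y))) := by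
    have hφxi : Integrable fun y => φ (x - y) :=
      hφx.continuous.integrable_of_hasCompactSupport hφxc
    refine tendsto_integral_of_dominated_convergence (fun y => S * ‖φ (x - y)‖)
      (fun n => ((hHsc n).mul hφx.continuous).aestronglyMeasurable) (hφxi.norm.const_mul S)
      (fun n => ae_of_all _ fun y => ?_) (ae_of_all _ fun y => ?_)
    · rw [norm_mul]
      exact mul_le_mul_of_nonneg_right (hHs_le n y) (norm_nonneg _)
    · have h1 : Tendsto (fun n => Hs n y) atTop (𝓝 (h y)) := by
        rw [hHs_def, hh_def]
        exact (ht_sum y).hasSum.tendsto_sum_nat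
      exact h1.mul tendsto_const_nhds
  -- assemble
  have key : (fun n => ∫ y, (∑ j ∈ Finset.range n,
      (-1 : ℂ) ^ j * b j * iteratedDeriv (2 * j) f y) * φ (x - y)) =
      fun n => (∫ y, G n y * σ y) + ∫ y, Hs n y * φ (x - y) := by
    funext n
    rw [← integral_add (hint1 n) (hint2 n)]
    exact integral_congr_ae (ae_of_all _ fun y => hsplit n y)
  rw [key]
  exact hT1.add hT2

/-- **Dixmier–Malliavin on `ℝ` from the uniform annulus bounds**: the named fact
`Literature.Analysis.Convolution.DixmierMalliavin_real` follows from the kernel package above through the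
factorization step `dixmierMalliavin_real_of_kernels_of_pos` (module `DixmierMalliavinFactorization`).
[cite: DixmierMalliavin1978, §3 Thm. 3.1] [cite: Hegde2021, §3.3 Thm. 18, Rem. 15] -/
theorem dixmierMalliavin_real_of_annulusBound (K : ℕ → ℝ)
    (hK : ∀ c : ℕ → ℝ, IsAdmissible c → ∀ (n : ℕ) (x : ℝ), (1 : ℝ) / 2 ≤ |x| →
      ‖iteratedDeriv n (psi c 0) x‖ ≤ K n) :
    DixmierMalliavin_real :=
  dixmierMalliavin_real_of_kernels_of_pos (exists_kernel_package_of_annulusBound K hK)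

end DixmierMalliavin

end Literature.Analysis.Convolution
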